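import Summits.BirchSwinnertonDyer.BirchSwinnertonDyer.Theorems.AdditiveBranchIMCGordTwoRankOneUnitCoeff
import HarnessLib

/-!
# Route `AdditiveBranchIMC` (rung K1), crux `GordTwoRankOne` (item 19358): the REDUCIBLE rows — on
# X3♯(G-ord) ∩ `I₀*` in analytic rank one, Case-1 member OR NOT, ONE `p`-adic unit `‖A′‖_p = 1` gives
# `BSD(E,p)` from Wuthrich's half + the cite-only facts (cell `bsd-addord`, seat `bsd-addord-k1-c3` gen 3,
# D-0074 row B2; `--supports stmt-BirchSwinnertonDyer-19358 --as helper`; sequel of `…GordTwoRankOneUnitCoeff`)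

HONEST FRAMING. THEOREMS ONLY: no definition, no named fact, no `sorry`, nothing booked; BSD is not proved by
any of this and the crux stays OPEN at class level (residuals (R1) Λ-adic layer off Case-1, (R2) `A′ ≠ 0` on
non-CM pairs — TARGET E68/E74; not attacked, H3). Published inputs are named-fact BINDERS: Wuthrich 2014 Thm. 16
on the half eigenspace (`hW16` = `Wuthrich2014.thm16_halfEigenCharIdeal_dvd_cyclotomicPrime`, a READING fact at an
additive prime: route item `WuthrichHalfEigenDivisibility`), Mazur 1972 Cor. 5.15 (`hMaz`), lit's fact (B) (`hCyc`;
`hCyc3` at `p = 3`), `hArt`, `h73`, `hWald`, Delbourgo 2002 (`hDel` / `hDel3`), modularity, GZK.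

WHAT. The companion file observed that in analytic rank ONE the Route-G budget at index `1` is a theorem
(`budgetLeLambdaAt_one_of_analyticRank_eq_one`), so that the b2b cell's K-OUT — here its X3♯ form WITHOUT any
image hypothesis, `ClassX3Gord.chiBranchLowerDivisibility[Odd]At_of_wuthrichHalf_of_coeffCert_of_budget`
(`Additive/CongruentPartnerMainConjectureX3Gord.lean`: Wuthrich's half squeezed by ONE unit coefficient) —
delivers the Λ-adic input (R1) AT THE PAIR from the single certificate `BranchUnitCoeffAt W p 1` (= `‖A′‖_p = 1`,
which also gives (R2) `A′ ≠ 0`). Composed with gen 0's X3♯ rank-one ends with the Λ-adic input DISPLAYED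
(`classX3Gord_bsdp_rankOne{,_odd,_three}_of_chiBranchLower[Odd]_of_cycLineFact[Three]_of_wuthrichHalf`,
`…Certificate.lean` §3) and gen 2's `not_hasCM_of_classX3Gord` (reducible (G-ord) rows are never CM), this gives:

* §1 `classX3Gord_bsdp_rankOne_of_wuthrichHalf_of_coeffCert_of_budget` / `…_of_unitCoeffOne` (`p ≡ 1 (mod 4)`);
* §2 the odd twins (`p ≡ 3 (mod 4)`, `p ≥ 7`);
* §3 `p = 3`, anomalous OR NOT (`hCyc3`, `hDel3`).

REACH (honest). The 383 X3♯ r1 keys booked so far (referee A R255/R261) are CASE-1 rows, where the Λ-adic input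
is the Greenberg–Vatsal transport (gz's end states) and the certificate is `A′ ≠ 0`. The theorems here need NO
Case-1 line datum: on ANY X3♯(G-ord) ∩ `I₀*` row of analytic rank one — the Eisenstein-degenerate / no-Case-1
classes included (μ-territory for the rank-0 crux) — the STRONGER certificate `v_p(A′) = 0` closes `BSD(E,p)`
modulo `hW16` and the cite-only facts; rows with `v_p(A′) ≥ 1` keep the index-`b` form with a budget input.

References: [Wuthrich2014] Thm. 16 (p. 397); [Delbourgo2002] Thm. (A), (B) (p. 40), Hypothesis (p. 39);
[Disegni2017] Thm. A, B; [Mazur1972Towers] Cor. 5.15; [GreenbergLNM1716] Lemma 3.1, Thm. 1.9;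
[MazurTateTeitelbaum1986Invent] §I.13–14; [GreenbergVatsal2000] Thm. (3.12) (context); [Miller2011LMS] Def. 1.1.
-/

set_option autoImplicit false
set_option linter.dupNamespace false

noncomputable section

open scoped Classical MatrixGroups ModularForm NumberField

open CongruenceSubgroup WeierstrassCurve NumberField IsDedekindDomain Field
  Literature.NumberTheory.EllipticCurves Literature.NumberTheory.EllipticCurves.ModularForms
  Literature.NumberTheory.EllipticCurves.GreenbergVatsal2000
  Literature.NumberTheory.EllipticCurves.Rank1Residual
  Literature.NumberTheory.EllipticCurves.Rank1Residual.Typed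
  Literature.NumberTheory.EllipticCurves.Delbourgo2002
  Literature.NumberTheory.EllipticCurves.Disegni2017
  Literature.NumberTheory.GaloisRepresentations
  Summit.BirchSwinnertonDyer.Rank1Residual.AdditivePotMult
  Summit.BirchSwinnertonDyer.Rank1Residual.Additive

namespace Summit.BirchSwinnertonDyer.BirchSwinnertonDyer.Theorems.AdditiveBranchIMCGordTwoRankOne

variable {W : WeierstrassCurve ℚ} [W.IsElliptic] [W.IsGloballyMinimal] {p : ℕ} [hp : Fact p.Prime]

/-! ### §1 X3♯(G-ord) ∩ `I₀*`, `p ≡ 1 (mod 4)` -/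

/-- **X3♯(G-ord) ∩ `I₀*` (`E[p]` reducible, `e = 2`), `p ≡ 1 (mod 4)`, `r_an = 1`, anomalous or not, Case-1
member or not: `BSD(E,p)` from the published facts, Wuthrich's half, ONE unit coefficient at index `b`
(`BranchUnitCoeffAt W p b`), a budget `BudgetLeLambdaAt p W b`, and `A′ ≠ 0`** — gen 0's
`classX3Gord_bsdp_rankOne_of_chiBranchLower_of_cycLineFact_of_wuthrichHalf` with its displayed Λ-adic input
supplied by the X3♯ K-OUT and `¬CM` by `not_hasCM_of_classX3Gord`. Nothing booked.
[cite: Wuthrich2014, Thm. 16 (p. 397)] [cite: MazurTateTeitelbaum1986Invent, §I.13–I.14]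
[cite: Delbourgo2002, Theorem (A), (B) (p. 40)] [cite: Disegni2017, Theorem A/B (arXiv v3 PDF 7–9)]
[cite: Miller2011LMS, Def. 1.1] -/
theorem classX3Gord_bsdp_rankOne_of_wuthrichHalf_of_coeffCert_of_budget
    (hW16 : Wuthrich2014.thm16_halfEigenCharIdeal_dvd_cyclotomicPrime)
    (hMaz : Mazur1972.cor515_universalNormIndex) (hCyc : delbourgoDatum_cycLineGrossZagier)
    (hArt : rankinSelbergEulerProductHecke_baseChangeDirichlet_eq) (h73 : GrossZagier1986_thm_I_7_3)
    (hWald : waldspurger_exists_heegnerField_twist_ne_zero) (hDel : Delbourgo2002.mainTheorem)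
    (hmod : hasEntireLFunction_rat) (hmodD : nonempty_modularParametrizationData)
    (hmodN : exists_isNewformOf) (hGZK : rank_eq_analyticRank_of_analyticRank_le_one)
    (hX : ClassX3Gord W p) (he : semistabilityIndex W p = 2) (hp4 : p % 4 = 1) (hr : W.analyticRank = 1)
    {b : ℕ} (hcert : BranchUnitCoeffAt W p b) (hbud : BudgetLeLambdaAt p W b)
    (hne : BranchCoeffOneNeZeroAt W p) : BSDp W p :=
  classX3Gord_bsdp_rankOne_of_chiBranchLower_of_cycLineFact_of_wuthrichHalf hW16 hMaz hCyc hArt h73 hWald hDel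
    hmod hmodD hmodN hGZK hX he hp4 (not_hasCM_of_classX3Gord hX (by omega)) hr
    (hX.chiBranchLowerDivisibilityAt_of_wuthrichHalf_of_coeffCert_of_budget hW16 hcert hbud) hne

/-- **ONE CERTIFICATE on the reducible rows.** X3♯(G-ord) ∩ `I₀*`, `p ≡ 1 (mod 4)`, `r_an(E) = 1`, anomalous or
not, Case-1 member or not: `BSD(E,p)` from the published facts, Wuthrich's half-eigenspace reading, and
`‖A′(E,p)‖_p = 1` (`BranchUnitCoeffAt W p 1`). Budget by `budgetLeLambdaAt_one_of_analyticRank_eq_one`, `A′ ≠ 0`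
from the unit, `¬CM` automatic. Nothing booked. [cite: Wuthrich2014, Thm. 16 (p. 397)]
[cite: GreenbergLNM1716, §3 Lemma 3.1] [cite: Delbourgo2002, Theorem (A), (B) (p. 40)]
[cite: Disegni2017, Theorem A/B (arXiv v3 PDF 7–9)] [cite: Miller2011LMS, Def. 1.1] -/
theorem classX3Gord_bsdp_rankOne_of_wuthrichHalf_of_unitCoeffOne
    (hW16 : Wuthrich2014.thm16_halfEigenCharIdeal_dvd_cyclotomicPrime)
    (hMaz : Mazur1972.cor515_universalNormIndex) (hCyc : delbourgoDatum_cycLineGrossZagier)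
    (hArt : rankinSelbergEulerProductHecke_baseChangeDirichlet_eq) (h73 : GrossZagier1986_thm_I_7_3)
    (hWald : waldspurger_exists_heegnerField_twist_ne_zero) (hDel : Delbourgo2002.mainTheorem)
    (hmod : hasEntireLFunction_rat) (hmodD : nonempty_modularParametrizationData)
    (hmodN : exists_isNewformOf) (hGZK : rank_eq_analyticRank_of_analyticRank_le_one)
    (hX : ClassX3Gord W p) (he : semistabilityIndex W p = 2) (hp4 : p % 4 = 1) (hr : W.analyticRank = 1)
    (hone : BranchUnitCoeffAt W p 1) : BSDp W p :=
  classX3Gord_bsdp_rankOne_of_wuthrichHalf_of_coeffCert_of_budget hW16 hMaz hCyc hArt h73 hWald hDel hmod hmodD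
    hmodN hGZK hX he hp4 hr hone (budgetLeLambdaAt_one_of_analyticRank_eq_one hGZK hr)
    (branchCoeffOneNeZeroAt_of_branchUnitCoeffAt_one hone)

/-! ### §2 X3♯(G-ord) ∩ `I₀*`, `p ≡ 3 (mod 4)`, `p ≥ 7` -/

/-- **Odd branch, index `b`, reducible rows.** X3♯(G-ord) ∩ `I₀*`, `p ≡ 3 (mod 4)`, `p ≥ 7`, `r_an = 1`:
`BSD(E,p)` from the published facts, Wuthrich's half, `BranchUnitCoeffAt W p b` + `BudgetLeLambdaAt p W b` and
`A′ ≠ 0` (gen 0's odd X3♯ end + the odd X3♯ K-OUT). [cite: Wuthrich2014, Thm. 16 (p. 397)]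
[cite: MazurTateTeitelbaum1986Invent, §I.13–I.14] [cite: Delbourgo2002, Theorem (A), (B) (p. 40)] [cite: Miller2011LMS, Def. 1.1] -/
theorem classX3Gord_bsdp_rankOne_odd_of_wuthrichHalf_of_coeffCert_of_budget
    (hW16 : Wuthrich2014.thm16_halfEigenCharIdeal_dvd_cyclotomicPrime)
    (hMaz : Mazur1972.cor515_universalNormIndex) (hCyc : delbourgoDatum_cycLineGrossZagier)
    (hArt : rankinSelbergEulerProductHecke_baseChangeDirichlet_eq) (h73 : GrossZagier1986_thm_I_7_3)
    (hWald : waldspurger_exists_heegnerField_twist_ne_zero) (hDel : Delbourgo2002.mainTheorem)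
    (hmod : hasEntireLFunction_rat) (hmodD : nonempty_modularParametrizationData)
    (hmodN : exists_isNewformOf) (hGZK : rank_eq_analyticRank_of_analyticRank_le_one)
    (hX : ClassX3Gord W p) (he : semistabilityIndex W p = 2) (hp4 : p % 4 = 3) (hp5 : 5 ≤ p)
    (hr : W.analyticRank = 1) {b : ℕ} (hcert : BranchUnitCoeffAt W p b) (hbud : BudgetLeLambdaAt p W b)
    (hne : BranchCoeffOneNeZeroAt W p) : BSDp W p :=
  classX3Gord_bsdp_rankOne_odd_of_chiBranchLowerOdd_of_cycLineFact_of_wuthrichHalf hW16 hMaz hCyc hArt h73 hWald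
    hDel hmod hmodD hmodN hGZK hX he hp4 hp5 (not_hasCM_of_classX3Gord hX (by omega)) hr
    (hX.chiBranchLowerDivisibilityOddAt_of_wuthrichHalf_of_coeffCert_of_budget hW16 hcert hbud) hne

/-- **Odd branch, ONE CERTIFICATE, reducible rows.** X3♯(G-ord) ∩ `I₀*`, `p ≡ 3 (mod 4)`, `p ≥ 7`, `r_an(E) = 1`:
`BSD(E,p)` from the published facts, Wuthrich's half-eigenspace reading, and `‖A′(E,p)‖_p = 1` (minus symbols).
[cite: Wuthrich2014, Thm. 16 (p. 397)] [cite: GreenbergLNM1716, §3 Lemma 3.1]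
[cite: Delbourgo2002, Theorem (A), (B) (p. 40)] [cite: Miller2011LMS, Def. 1.1] -/
theorem classX3Gord_bsdp_rankOne_odd_of_wuthrichHalf_of_unitCoeffOne
    (hW16 : Wuthrich2014.thm16_halfEigenCharIdeal_dvd_cyclotomicPrime)
    (hMaz : Mazur1972.cor515_universalNormIndex) (hCyc : delbourgoDatum_cycLineGrossZagier)
    (hArt : rankinSelbergEulerProductHecke_baseChangeDirichlet_eq) (h73 : GrossZagier1986_thm_I_7_3)
    (hWald : waldspurger_exists_heegnerField_twist_ne_zero) (hDel : Delbourgo2002.mainTheorem)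
    (hmod : hasEntireLFunction_rat) (hmodD : nonempty_modularParametrizationData)
    (hmodN : exists_isNewformOf) (hGZK : rank_eq_analyticRank_of_analyticRank_le_one)
    (hX : ClassX3Gord W p) (he : semistabilityIndex W p = 2) (hp4 : p % 4 = 3) (hp5 : 5 ≤ p)
    (hr : W.analyticRank = 1) (hone : BranchUnitCoeffAt W p 1) : BSDp W p :=
  classX3Gord_bsdp_rankOne_odd_of_wuthrichHalf_of_coeffCert_of_budget hW16 hMaz hCyc hArt h73 hWald hDel hmod
    hmodD hmodN hGZK hX he hp4 hp5 hr hone (budgetLeLambdaAt_one_of_analyticRank_eq_one hGZK hr)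
    (branchCoeffOneNeZeroAt_of_branchUnitCoeffAt_one hone)

/-! ### §3 X3♯(G-ord) at `p = 3`, anomalous OR NOT, line datum OR NOT -/

/-- **`p = 3`, index `b`, reducible rows.** X3♯(G-ord) at `3` (`e = 2` automatic), `r_an = 1`, ANOMALOUS OR NOT,
Case-1 line datum or not: `BSD(E,3)` from the published facts (`hW16`; `hMaz`, lit's `p = 3` (B♮) fact `hCyc3`,
`hArt h73 hWald`, `hDel3`, modularity, GZK), `BranchUnitCoeffAt W 3 b` + `BudgetLeLambdaAt 3 W b` and `A′ ≠ 0`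
(gen 0's `classX3Gord_bsdp_rankOne_three_…_of_wuthrichHalf` + the odd X3♯ K-OUT at `3`).
[cite: Wuthrich2014, Thm. 16 (p. 397)] [cite: Delbourgo2002, Theorem (A), (B), Example (p. 40); Hypothesis (p. 39)]
[cite: MazurTateTeitelbaum1986Invent, §I.13–I.14] [cite: Miller2011LMS, Def. 1.1] -/
theorem classX3Gord_bsdp_rankOne_three_of_wuthrichHalf_of_coeffCert_of_budget
    [Fact (Nat.Prime 3)] {W : WeierstrassCurve ℚ} [W.IsElliptic] [W.IsGloballyMinimal]
    (hW16 : Wuthrich2014.thm16_halfEigenCharIdeal_dvd_cyclotomicPrime)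
    (hMaz : Mazur1972.cor515_universalNormIndex) (hCyc3 : delbourgoDatum_cycLineGrossZagier_intrinsicThree)
    (hArt : rankinSelbergEulerProductHecke_baseChangeDirichlet_eq) (h73 : GrossZagier1986_thm_I_7_3)
    (hWald : waldspurger_exists_heegnerField_twist_ne_zero) (hDel3 : Delbourgo2002.mainTheorem_three)
    (hmod : hasEntireLFunction_rat) (hmodD : nonempty_modularParametrizationData)
    (hmodN : exists_isNewformOf) (hGZK : rank_eq_analyticRank_of_analyticRank_le_one)
    (hX : ClassX3Gord W 3) (hr : W.analyticRank = 1) {b : ℕ} (hcert : BranchUnitCoeffAt W 3 b)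
    (hbud : BudgetLeLambdaAt 3 W b) (hne : BranchCoeffOneNeZeroAt W 3) : BSDp W 3 :=
  classX3Gord_bsdp_rankOne_three_of_chiBranchLowerOdd_of_cycLineFactThree_of_wuthrichHalf hW16 hMaz hCyc3 hArt
    h73 hWald hDel3 hmod hmodD hmodN hGZK hX (not_hasCM_of_classX3Gord hX (by norm_num)) hr
    (hX.chiBranchLowerDivisibilityOddAt_of_wuthrichHalf_of_coeffCert_of_budget hW16 hcert hbud) hne

/-- **`p = 3`, ONE CERTIFICATE, reducible rows.** X3♯(G-ord) at `3`, `r_an(E) = 1`, anomalous or not, line datum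
or not: `BSD(E,3)` from the published facts, Wuthrich's half-eigenspace reading, and `‖A′(E,3)‖_3 = 1`
(`BranchUnitCoeffAt W 3 1`). This is the `A′`-UNIT slice of the cell's `p = 3` X3♯ r1 universe (book230: 799
classes with a line datum, 416 of them still gated on `A′(E,3) ≠ 0` at certificate grade after R261) reached
WITHOUT the line datum. Nothing booked. [cite: Wuthrich2014, Thm. 16 (p. 397)]
[cite: Delbourgo2002, Theorem (A), (B), Example (p. 40)] [cite: GreenbergLNM1716, §3 Lemma 3.1] [cite: Miller2011LMS, Def. 1.1] -/
theorem classX3Gord_bsdp_rankOne_three_of_wuthrichHalf_of_unitCoeffOne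
    [Fact (Nat.Prime 3)] {W : WeierstrassCurve ℚ} [W.IsElliptic] [W.IsGloballyMinimal]
    (hW16 : Wuthrich2014.thm16_halfEigenCharIdeal_dvd_cyclotomicPrime)
    (hMaz : Mazur1972.cor515_universalNormIndex) (hCyc3 : delbourgoDatum_cycLineGrossZagier_intrinsicThree)
    (hArt : rankinSelbergEulerProductHecke_baseChangeDirichlet_eq) (h73 : GrossZagier1986_thm_I_7_3)
    (hWald : waldspurger_exists_heegnerField_twist_ne_zero) (hDel3 : Delbourgo2002.mainTheorem_three)
    (hmod : hasEntireLFunction_rat) (hmodD : nonempty_modularParametrizationData)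
    (hmodN : exists_isNewformOf) (hGZK : rank_eq_analyticRank_of_analyticRank_le_one)
    (hX : ClassX3Gord W 3) (hr : W.analyticRank = 1) (hone : BranchUnitCoeffAt W 3 1) : BSDp W 3 :=
  classX3Gord_bsdp_rankOne_three_of_wuthrichHalf_of_coeffCert_of_budget hW16 hMaz hCyc3 hArt h73 hWald hDel3
    hmod hmodD hmodN hGZK hX hr hone (budgetLeLambdaAt_one_of_analyticRank_eq_one hGZK hr)
    (branchCoeffOneNeZeroAt_of_branchUnitCoeffAt_one hone)

end Summit.BirchSwinnertonDyer.BirchSwinnertonDyer.Theorems.AdditiveBranchIMCGordTwoRankOne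

end
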